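/-
Copyright (c) 2026. All rights reserved.
Released under Apache 2.0 license as described in the file LICENSE.
-/
import Mathlib
import HarnessLib
import Literature.MathematicalPhysics.QuantumLattice.GaugeGroups
import Literature.MathematicalPhysics.QuantumFieldTheory.ConstructiveQFTWave0
import Literature.MathematicalPhysics.QuantumFieldTheory.LatticeGaugeProofs
import Literature.MathematicalPhysics.QuantumLattice.AbelianFieldTensor
import Literature.MathematicalPhysics.QuantumLattice.AbelianMagneticFlux
import Summits.Ventures.LatticeQCDFlow.Scaling.FluxSectorCollar
import Summits.Ventures.LatticeQCDFlow.Scaling.SliceTwistWitness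
import Summits.Ventures.LatticeQCDFlow.Scaling.RowFields
import Summits.Ventures.LatticeQCDFlow.Scaling.BoxSpreadWitness
import Summits.Ventures.LatticeQCDFlow.Scaling.FluxInsertionKernel
import Summits.Ventures.LatticeQCDFlow.Scaling.FluxInsertionBox

/-!
# The action floor of a nonzero flux sector on the two-dimensional torus, and the
full-range tangent bound for `1 − cos` (lean-1 GEN-6, own work)

HONEST FRAMING: exact (Metropolis-corrected) sampling algorithms for lattice gauge theory;
figures of merit are autocorrelation/cost numbers at stated couplings and volumes; no
continuum-physics claim.

Venture `LatticeQCDFlow` (cell pub-lqcd), topic `Scaling`, FANOUT row 30 (lean-1).  NEW WORK of the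
cell; nothing here is cited as a fact.  Compact `U(1)`, `d = 2`, torus `(ℤ/L)²`, Wilson action
`S(U) = Σ_x (1 − cos F(x))` with `F(x) = arg U_p(x) ∈ (−π, π]` the plaquette angle, Lüscher's flux
charge `Q(U) = Σ_x F(x)/(2π) ∈ ℤ` (`Flux.topCharge 0 0 1`).

**§1 Tangent bound, full range.**  For `0 ≤ c ≤ 7/10` and EVERY `φ ≤ π`:
`(1 − cos c) + sin c·(φ − c) ≤ 1 − cos φ` (`tangent_le_one_sub_cos`), strict for `c < φ ≤ π − c`
(`tangent_lt_one_sub_cos`).  (The tree's `Trig.cos_le_cos_sub_sin_mul` covers `φ ∈ [0, π − c]`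
only; the mountain-pass argument of `FluxInsertionHeightValue` needs the SIGNED linear term on the
whole period, which costs the restriction `c ≤ 7/10`.)  Summed form with the signed linear term
(`sum_tangent_le`) and the threshold form `|Σ φ_i| ≥ m·c ⇒ Σ (1 − cos φ_i) ≥ m(1 − cos c)`
(`card_mul_le_sum_one_sub_cos_of_abs_sum_ge`).

**§2 Site sums.**  `S(U) = Σ_{x : Site 2 L} (1 − cos F(x))` and `2π·Q(U) = Σ_x F(x)`
(`wilsonAction_eq_sum_site`, `two_pi_mul_topCharge_eq_sum_site`).

**§3 The sector action floor.**  If `Q(V) ≠ 0` and `3 ≤ L` then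
`L²(1 − cos(2π/L²)) ≤ S(V)` (`wilsonAction_ge_of_topCharge_ne_zero`): the evenly spread unit of
flux minimises the action in every nonzero sector.

**§4 The insertion jump decomposition.**  For the block spread `W = boxSpread l` (`2 ≤ l`,
`l + 1 ≤ L`) and ANY `U`: `F_{WU}(x) = F_U(x) + boxF(x) + 2π m(x)` with `m(x) ∈ {0, −1}`
(`exists_jump_boxSpread_mul`), hence `Q(WU) = Q(U) + 1 + Σ_x m(x)`.
-/

noncomputable section

open Real Set
open Literature.MathematicalPhysics.QuantumFieldTheory Literature.MathematicalPhysics.QuantumLattice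

namespace Summit.Ventures.LatticeQCDFlow.Theory2.Lattice.Flux

/-! ## §1 The full-range tangent bound for `1 − cos` -/

section Tangent

/-- The gap function `g(φ) = cos c − cos φ − sin c (φ − c)` has derivative `sin φ − sin c`.
[folklore] -/
theorem hasDerivAt_tangentGap (c φ : ℝ) :
    HasDerivAt (fun y : ℝ => Real.cos c - Real.cos y - Real.sin c * (y - c))
      (Real.sin φ - Real.sin c) φ := by
  have h : HasDerivAt (fun y : ℝ => Real.cos c - Real.cos y - Real.sin c * (y - c))
      (0 - -Real.sin φ - Real.sin c * 1) φ :=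
    ((hasDerivAt_const φ (Real.cos c)).sub (Real.hasDerivAt_cos φ)).sub
      (((hasDerivAt_id' φ).sub_const c).const_mul (Real.sin c))
  have e : (0 : ℝ) - -Real.sin φ - Real.sin c * 1 = Real.sin φ - Real.sin c := by ring
  rw [e] at h
  exact h

/-- The gap is non-negative left of the tangency point: for `φ ≤ c` with `0 ≤ c ≤ π/2`,
`cos c − cos φ − sin c (φ − c) ≥ 0` (no upper bound on `c − φ` needed). [folklore] -/
theorem tangentGap_nonneg_of_le {c φ : ℝ} (hc0 : 0 ≤ c) (hc : c ≤ π / 2) (hφ : φ ≤ c) :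
    0 ≤ Real.cos c - Real.cos φ - Real.sin c * (φ - c) := by
  have hcos : 0 ≤ Real.cos c :=
    Real.cos_nonneg_of_neg_pi_div_two_le_of_le (by linarith [Real.pi_pos]) hc
  have hsin : 0 ≤ Real.sin c := Real.sin_nonneg_of_nonneg_of_le_pi hc0 (by linarith [Real.pi_pos])
  have hδ : φ - c ≤ Real.sin (φ - c) := Real.le_sin (by linarith)
  have h1 : Real.cos (φ - c) ≤ 1 := Real.cos_le_one _
  have e : Real.cos φ = Real.cos c * Real.cos (φ - c) - Real.sin c * Real.sin (φ - c) := by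
    rw [← Real.cos_add]; congr 1; ring
  rw [e]
  nlinarith [mul_nonneg hcos (sub_nonneg.2 h1), mul_nonneg hsin (sub_nonneg.2 hδ)]

/-- The gap is strictly increasing on `[c, π − c]` (`0 ≤ c`). [folklore] -/
theorem strictMonoOn_tangentGap {c : ℝ} (hc0 : 0 ≤ c) :
    StrictMonoOn (fun y : ℝ => Real.cos c - Real.cos y - Real.sin c * (y - c)) (Icc c (π - c)) := by
  refine strictMonoOn_of_deriv_pos (convex_Icc _ _)
    (Continuous.continuousOn (by fun_prop)) fun y hy => ?_
  rw [interior_Icc] at hy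
  rw [(hasDerivAt_tangentGap c y).deriv, sub_pos]
  rcases le_or_gt y (π / 2) with hy2 | hy2
  · exact Real.sin_lt_sin_of_lt_of_le_pi_div_two (by linarith [Real.pi_pos]) hy2 hy.1
  · rw [← Real.sin_pi_sub y]
    exact Real.sin_lt_sin_of_lt_of_le_pi_div_two (by linarith [Real.pi_pos]) (by linarith)
      (by linarith [hy.2])

/-- The gap is decreasing on `[π − c, π]` (`0 ≤ c ≤ π/2`). [folklore] -/
theorem antitoneOn_tangentGap {c : ℝ} (hc0 : 0 ≤ c) (hc : c ≤ π / 2) :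
    AntitoneOn (fun y : ℝ => Real.cos c - Real.cos y - Real.sin c * (y - c)) (Icc (π - c) π) := by
  refine antitoneOn_of_deriv_nonpos (convex_Icc _ _)
    (Continuous.continuousOn (by fun_prop))
    (fun y _ => (hasDerivAt_tangentGap c y).differentiableAt.differentiableWithinAt) fun y hy => ?_
  rw [interior_Icc] at hy
  rw [(hasDerivAt_tangentGap c y).deriv, sub_nonpos, ← Real.sin_pi_sub y]
  exact Real.sin_le_sin_of_le_of_le_pi_div_two (by linarith [hy.2]) hc (by linarith [hy.1])

/-- The gap at `φ = π` is non-negative for `0 ≤ c ≤ 7/10`: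
`1 + cos c − sin c (π − c) ≥ 2 + c²/2 − π c ≥ 0`. [folklore] -/
theorem tangentGap_pi_nonneg {c : ℝ} (hc0 : 0 ≤ c) (hc : c ≤ 7 / 10) :
    0 ≤ Real.cos c - Real.cos π - Real.sin c * (π - c) := by
  rw [Real.cos_pi]
  have h1 : 1 - c ^ 2 / 2 ≤ Real.cos c := Real.one_sub_sq_div_two_le_cos
  have h2 : Real.sin c ≤ c := Real.sin_le hc0
  have h3 : 0 ≤ Real.sin c := Real.sin_nonneg_of_nonneg_of_le_pi hc0 (by linarith [Real.pi_gt_three])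
  have hπ := Real.pi_lt_d2
  have h4 : 0 ≤ π - c := by linarith [Real.pi_gt_three]
  nlinarith [mul_le_mul_of_nonneg_right h2 h4, mul_nonneg (sub_nonneg.2 hc)
    (show (0 : ℝ) ≤ 3.15 - (c + 7 / 10) / 2 by linarith)]

/-- **Full-range tangent bound.**  For `0 ≤ c ≤ 7/10` and every `φ ≤ π`:
`(1 − cos c) + sin c·(φ − c) ≤ 1 − cos φ`. [folklore] -/
theorem tangent_le_one_sub_cos {c φ : ℝ} (hc0 : 0 ≤ c) (hc : c ≤ 7 / 10) (hφ2 : φ ≤ π) :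
    (1 - Real.cos c) + Real.sin c * (φ - c) ≤ 1 - Real.cos φ := by
  have hcπ : c ≤ π / 2 := by linarith [Real.pi_gt_three]
  suffices h : 0 ≤ Real.cos c - Real.cos φ - Real.sin c * (φ - c) by linarith
  rcases le_or_gt φ c with h1 | h1
  · exact tangentGap_nonneg_of_le hc0 hcπ h1
  rcases le_or_gt φ (π - c) with h2 | h2
  · have h := (strictMonoOn_tangentGap hc0).monotoneOn ⟨le_rfl, by linarith⟩ ⟨h1.le, h2⟩ h1.le
    simp only [sub_self, mul_zero] at h
    linarith
  · have hπ' := (antitoneOn_tangentGap hc0 hcπ) ⟨h2.le, hφ2⟩ ⟨by linarith, le_rfl⟩ hφ2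
    exact (tangentGap_pi_nonneg hc0 hc).trans hπ'

/-- **Strict tangent bound** on `(c, π − c]`. [folklore] -/
theorem tangent_lt_one_sub_cos {c φ : ℝ} (hc0 : 0 ≤ c) (hcφ : c < φ) (hφ : φ ≤ π - c) :
    (1 - Real.cos c) + Real.sin c * (φ - c) < 1 - Real.cos φ := by
  have h := strictMonoOn_tangentGap hc0 ⟨le_rfl, by linarith⟩ ⟨hcφ.le, hφ⟩ hcφ
  simp only [sub_self, mul_zero] at h
  linarith

/-- **Summed tangent bound with the signed linear term.**  For `0 ≤ c ≤ 7/10` and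
`φ_i ∈ [−π, π]`: `#s·(1 − cos c) + sin c·(Σ φ_i − #s·c) ≤ Σ (1 − cos φ_i)`. [folklore] -/
theorem sum_tangent_le {ι : Type*} (s : Finset ι) (φ : ι → ℝ) {c : ℝ} (hc0 : 0 ≤ c)
    (hc : c ≤ 7 / 10) (hφ : ∀ i ∈ s, -π ≤ φ i ∧ φ i ≤ π) :
    (s.card : ℝ) * (1 - Real.cos c) + Real.sin c * (∑ i ∈ s, φ i - s.card * c) ≤
      ∑ i ∈ s, (1 - Real.cos (φ i)) := by
  have e : (s.card : ℝ) * (1 - Real.cos c) + Real.sin c * (∑ i ∈ s, φ i - s.card * c) =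
      ∑ i ∈ s, ((1 - Real.cos c) + Real.sin c * (φ i - c)) := by
    rw [Finset.sum_add_distrib, Finset.sum_const, nsmul_eq_mul, ← Finset.mul_sum,
      Finset.sum_sub_distrib, Finset.sum_const, nsmul_eq_mul]
  rw [e]
  exact Finset.sum_le_sum fun i hi => tangent_le_one_sub_cos hc0 hc (hφ i hi).2

/-- The same bound for the reflected angles: `#s·(1 − cos c) + sin c·(−Σ φ_i − #s·c) ≤ Σ (1 − cos φ_i)`.
[folklore] -/
theorem sum_tangent_le_neg {ι : Type*} (s : Finset ι) (φ : ι → ℝ) {c : ℝ} (hc0 : 0 ≤ c)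
    (hc : c ≤ 7 / 10) (hφ : ∀ i ∈ s, -π ≤ φ i ∧ φ i ≤ π) :
    (s.card : ℝ) * (1 - Real.cos c) + Real.sin c * (-∑ i ∈ s, φ i - s.card * c) ≤
      ∑ i ∈ s, (1 - Real.cos (φ i)) := by
  have h := sum_tangent_le s (fun i => -φ i) hc0 hc
    (fun i hi => ⟨by linarith [(hφ i hi).2], by linarith [(hφ i hi).1]⟩)
  simp only [Real.cos_neg, Finset.sum_neg_distrib] at h
  exact h

/-- **Threshold form.**  If `|Σ_{i∈s} φ_i| ≥ #s·c` (`0 ≤ c ≤ 7/10`, `φ_i ∈ [−π, π]`) then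
`#s·(1 − cos c) ≤ Σ (1 − cos φ_i)`. [folklore] -/
theorem card_mul_le_sum_one_sub_cos_of_abs_sum_ge {ι : Type*} (s : Finset ι) (φ : ι → ℝ)
    {c : ℝ} (hc0 : 0 ≤ c) (hc : c ≤ 7 / 10) (hφ : ∀ i ∈ s, -π ≤ φ i ∧ φ i ≤ π)
    (hsum : (s.card : ℝ) * c ≤ |∑ i ∈ s, φ i|) :
    (s.card : ℝ) * (1 - Real.cos c) ≤ ∑ i ∈ s, (1 - Real.cos (φ i)) := by
  have hsin : 0 ≤ Real.sin c := Real.sin_nonneg_of_nonneg_of_le_pi hc0 (by linarith [Real.pi_gt_three])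
  rcases le_or_gt 0 (∑ i ∈ s, φ i) with h | h
  · rw [abs_of_nonneg h] at hsum
    have := sum_tangent_le s φ hc0 hc hφ
    nlinarith [mul_nonneg hsin (sub_nonneg.2 hsum)]
  · rw [abs_of_neg h] at hsum
    have := sum_tangent_le_neg s φ hc0 hc hφ
    nlinarith [mul_nonneg hsin (sub_nonneg.2 hsum)]

end Tangent

/-! ## §2 Action and charge as site sums (`d = 2`) -/

section SiteSums

variable {L : ℕ} [NeZero L]

/-- **The `U(1)` Wilson action on the two-dimensional torus is `Σ_x (1 − cos F(x))`.** [folklore] -/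
theorem wilsonAction_eq_sum_site (U : GaugeConfig 2 L Circle) :
    wilsonAction u1Rep U = ∑ x : Site 2 L, (1 - Real.cos (abelianFieldTensor U x 0 1)) := by
  rw [wilsonAction_u1_eq]
  refine Fintype.sum_equiv plaquetteEquivSite _ _ fun q => ?_
  obtain ⟨h0, h1⟩ := plaquette_dirs_eq q
  rw [h0, h1, ← exp_abelianFieldTensor U q.1 0 1, Circle.coe_exp, Complex.exp_ofReal_mul_I_re]
  rfl

/-- **The flux charge is the total plaquette angle**: `2π·Q(U) = Σ_x F(x)`. [folklore] -/
theorem two_pi_mul_topCharge_eq_sum_site (U : GaugeConfig 2 L Circle) :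
    2 * π * topCharge (0 : Site 2 L) 0 1 U = ∑ x : Site 2 L, abelianFieldTensor U x 0 1 := by
  have hπ : (2 : ℝ) * π ≠ 0 := by positivity
  have hre : ∑ x : Site 2 L, abelianFieldTensor U x 0 1 =
      ∑ s : ZMod L, ∑ t : ZMod L, abelianFieldTensor U
        ((0 : Site 2 L) + Pi.single (0 : Fin 2) s + Pi.single (1 : Fin 2) t) 0 1 := by
    rw [← Fintype.sum_prod_type']
    refine Fintype.sum_equiv (piFinTwoEquiv fun _ => ZMod L) _ _ fun x => ?_
    congr 1
    ext i
    fin_cases i <;> simp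
  unfold topCharge magneticFlux
  rw [hre]
  field_simp

/-- The total plaquette angle is `2π` times an integer. [folklore] -/
theorem exists_int_sum_site_eq (U : GaugeConfig 2 L Circle) :
    ∃ n : ℤ, ∑ x : Site 2 L, abelianFieldTensor U x 0 1 = 2 * π * n := by
  obtain ⟨n, hn⟩ := exists_int_eq_topCharge (0 : Site 2 L) 0 1 U
  exact ⟨n, by rw [← two_pi_mul_topCharge_eq_sum_site, hn]⟩

/-- The number of sites of the two-dimensional torus is `L²`. [folklore] -/
theorem card_site_two : Fintype.card (Site 2 L) = L ^ 2 := by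
  rw [Fintype.card_pi, Finset.prod_const, ZMod.card, Finset.card_univ, Fintype.card_fin]

end SiteSums

/-! ## §3 The action floor of a nonzero sector -/

section SectorFloor

variable {L : ℕ} [NeZero L]

omit [NeZero L] in
/-- `2π/L² ≤ 7/10` for `3 ≤ L`. [folklore] -/
theorem two_pi_div_sq_le (hL : 3 ≤ L) : 2 * π / (L : ℝ) ^ 2 ≤ 7 / 10 := by
  have hL' : (3 : ℝ) ≤ L := by exact_mod_cast hL
  have h9 : (9 : ℝ) ≤ (L : ℝ) ^ 2 := by nlinarith
  rw [div_le_iff₀ (by positivity)]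
  nlinarith [Real.pi_lt_d2]

/-- **THE SECTOR ACTION FLOOR.**  On the `L × L` torus (`3 ≤ L`) every `U(1)` configuration of
nonzero flux charge has Wilson action at least `L²(1 − cos(2π/L²))` — the action of one unit of
flux spread evenly. [folklore] -/
theorem wilsonAction_ge_of_topCharge_ne_zero (hL : 3 ≤ L) (V : GaugeConfig 2 L Circle)
    (hQ : topCharge (0 : Site 2 L) 0 1 V ≠ 0) :
    (L : ℝ) ^ 2 * (1 - Real.cos (2 * π / (L : ℝ) ^ 2)) ≤ wilsonAction u1Rep V := by
  rw [wilsonAction_eq_sum_site]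
  have hcard : ((Finset.univ : Finset (Site 2 L)).card : ℝ) = (L : ℝ) ^ 2 := by
    rw [Finset.card_univ, card_site_two]; push_cast; ring
  have hL0 : (0 : ℝ) < (L : ℝ) ^ 2 := by
    have : (3 : ℝ) ≤ L := by exact_mod_cast hL
    positivity
  obtain ⟨n, hn⟩ := exists_int_eq_topCharge (0 : Site 2 L) 0 1 V
  have hn0 : n ≠ 0 := by rintro rfl; rw [hn, Int.cast_zero] at hQ; exact hQ rfl
  have hn1 : (1 : ℝ) ≤ |(n : ℝ)| := by
    rw [← Int.cast_abs]; exact_mod_cast Int.one_le_abs hn0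
  have hsum : ((Finset.univ : Finset (Site 2 L)).card : ℝ) * (2 * π / (L : ℝ) ^ 2) ≤
      |∑ x : Site 2 L, abelianFieldTensor V x 0 1| := by
    rw [hcard, ← two_pi_mul_topCharge_eq_sum_site, hn]
    have e : (L : ℝ) ^ 2 * (2 * π / (L : ℝ) ^ 2) = 2 * π := by field_simp
    rw [e, abs_mul, abs_of_pos Real.two_pi_pos]
    nlinarith [Real.pi_pos]
  have h := card_mul_le_sum_one_sub_cos_of_abs_sum_ge Finset.univ
    (fun x : Site 2 L => abelianFieldTensor V x 0 1) (by positivity) (two_pi_div_sq_le hL)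
    (fun x _ => ⟨(neg_pi_lt_abelianFieldTensor V x 0 1).le, abelianFieldTensor_le_pi V x 0 1⟩) hsum
  rwa [hcard] at h

end SectorFloor

/-! ## §4 The jump decomposition of a block insertion -/

section Jumps

variable {L : ℕ} [NeZero L] {l : ℕ}

/-- **Jump decomposition.**  For every configuration `U` and every site `x`, the plaquette angle
after the block insertion is `F_{WU}(x) = F_U(x) + boxF(x) + 2π m` with `m ∈ {0, −1}`.
[folklore] -/
theorem exists_jump_boxSpread_mul (hl : 2 ≤ l) (hlL : l + 1 ≤ L) (U : GaugeConfig 2 L Circle)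
    (x : Site 2 L) : ∃ m : ℤ, (m = 0 ∨ m = -1) ∧
      abelianFieldTensor (boxSpread l * U) x 0 1 =
        abelianFieldTensor U x 0 1 + boxF l (x 0).val (x 1).val + 2 * π * m := by
  have hexp : Circle.exp (abelianFieldTensor (boxSpread l * U) x 0 1) =
      Circle.exp (abelianFieldTensor U x 0 1 + boxF l (x 0).val (x 1).val) := by
    rw [exp_abelianFieldTensor, plaquetteHolonomy_mul', plaquetteHolonomy_boxSpread hl hlL,
      Circle.exp_add, exp_abelianFieldTensor, mul_comm]
  obtain ⟨m, hm⟩ := Circle.exp_eq_exp.mp hexp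
  refine ⟨m, ?_, by rw [hm]; ring⟩
  have h1 := neg_pi_lt_abelianFieldTensor (boxSpread l * U) x 0 1
  have h2 := abelianFieldTensor_le_pi (boxSpread l * U) x 0 1
  have h3 := neg_pi_lt_abelianFieldTensor U x 0 1
  have h4 := abelianFieldTensor_le_pi U x 0 1
  have h5 := boxF_nonneg hl (x 0).val (x 1).val
  have h6 := (boxF_le hl (x 0).val (x 1).val).trans (boxAlpha_lt_pi hl).le
  have hlt : (m : ℝ) < 1 := by nlinarith [Real.pi_pos]
  have hgt : (-2 : ℝ) < m := by nlinarith [Real.pi_pos]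
  have hlt' : m < 1 := by exact_mod_cast hlt
  have hgt' : -2 < m := by exact_mod_cast hgt
  omega

omit [NeZero L] in
/-- After a jump (`m = −1`) the original plaquette angle exceeds `π − α_l`, so its action is at
least `1 + cos α_l`. [folklore] -/
theorem one_add_cos_le_of_jump (hl : 2 ≤ l) {U : GaugeConfig 2 L Circle}
    {x : Site 2 L} (h : abelianFieldTensor (boxSpread l * U) x 0 1 =
      abelianFieldTensor U x 0 1 + boxF l (x 0).val (x 1).val + 2 * π * (-1 : ℤ)) :
    1 + Real.cos (boxAlpha l) ≤ 1 - Real.cos (abelianFieldTensor U x 0 1) := by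
  have h1 := neg_pi_lt_abelianFieldTensor (boxSpread l * U) x 0 1
  have h4 := abelianFieldTensor_le_pi U x 0 1
  have h6 := boxF_le hl (x 0).val (x 1).val
  have hα := boxAlpha_pos hl
  have hαπ := boxAlpha_lt_pi hl
  push_cast at h
  have hF : π - boxAlpha l ≤ abelianFieldTensor U x 0 1 := by linarith
  have hcos : Real.cos (abelianFieldTensor U x 0 1) ≤ Real.cos (π - boxAlpha l) :=
    Real.cos_le_cos_of_nonneg_of_le_pi (by linarith) h4 hF
  rw [Real.cos_pi_sub] at hcos
  linarith

/-- **Charge change under the insertion**: with the jumps `m(x)` of `exists_jump_boxSpread_mul`,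
`Q(WU) = Q(U) + 1 + Σ_x m(x)`. [folklore] -/
theorem topCharge_boxSpread_mul_eq (hl : 2 ≤ l) (hlL : l + 1 ≤ L) (U : GaugeConfig 2 L Circle)
    (m : Site 2 L → ℤ) (hm : ∀ x, abelianFieldTensor (boxSpread l * U) x 0 1 =
      abelianFieldTensor U x 0 1 + boxF l (x 0).val (x 1).val + 2 * π * m x) :
    topCharge (0 : Site 2 L) 0 1 (boxSpread l * U) =
      topCharge (0 : Site 2 L) 0 1 U + 1 + ∑ x : Site 2 L, (m x : ℝ) := by
  have hπ : (2 : ℝ) * π ≠ 0 := by positivity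
  have h1 := two_pi_mul_topCharge_eq_sum_site (boxSpread l * U)
  have h2 := two_pi_mul_topCharge_eq_sum_site U
  simp only [hm, Finset.sum_add_distrib, sum_boxF_site hl hlL, ← Finset.mul_sum] at h1
  apply mul_left_cancel₀ hπ
  rw [h1, mul_add, mul_add, h2, mul_one]

end Jumps

end Summit.Ventures.LatticeQCDFlow.Theory2.Lattice.Flux

end
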